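import Literature.AnabelianGeometry.SemiGraphs.CyclicCovering
import Literature.AnabelianGeometry.SemiGraphs.SubdivisionLemmas
import Literature.AnabelianGeometry.SemiGraphs.SemiGraphLocal

/-!
# The cyclic covering is connected over a loop ([SemiAnbd] Prop. 2.6, p. 29)

Mochizuki, *Semi-graphs of anabelioids*, Publ. RIMS **42** (2006) 221–322, §2, proof of
Proposition 2.6, p. 29 [cite: MochizukiSemiAnbd2006, Prop. 2.6 p.29]: "by using the loop `L` of
`ℍ` constituted by `e_a`, `e_b`, we may construct a finite graph-covering of degree `M`, `𝔾′ → 𝔾`,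
which is trivial over `𝕂`, but connected over `L`."  For the cyclic covering `𝔾_M → 𝔾` twisted
along a branch `b₀` of `e_a` (`CyclicCovering.lean`) this file proves the combinatorial half:
`cyclicCover_preimage_isConnected` — if `ℍ ⊆ 𝔾` is a connected sub-semi-graph containing `e_a`,
the two vertices `v₀`, `v₁` to which its branches abut, and a second edge `e_b` with branches
abutting to `v₀` and to `v₁`, then the inverse image of `ℍ` in `𝔾_M` is connected.  (Walks of the
subdivision of `ℍ` lift level by level, the level changing only across the incidence `b₀ — v₀`;
the loop `v₁ — e_a — v₀ — e_b — v₁` lifts to a path from level `i` to level `i + 1`.)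
Proof-only, no definitions.
-/

namespace Literature.AnabelianGeometry.SemiGraphs

namespace SemiGraph

open CategoryTheory

universe u

variable (G : SemiGraph.{u}) (b₀ : G.Branch) (M : ℕ) [NeZero M]

/-- **The cyclic covering is connected over a loop through the twisted edge** ([SemiAnbd] p. 29,
"connected over `L`"): for a connected sub-semi-graph `ℍ` containing the edge `e_a` of `b₀`, the
vertices `v₀ ← b₀` and `v₁ ← b₀′` (the other branch of `e_a`), and branches `c → v₀`, `c′ → v₁` of a
common second edge `e_b ≠ e_a` of `ℍ`, the inverse image of `ℍ` in the degree-`M` cyclic covering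
twisted along `b₀` is a connected sub-semi-graph. [cite: MochizukiSemiAnbd2006, Prop. 2.6 p.29] -/
theorem cyclicCover_preimage_isConnected (H : G.Subgraph) (hH : H.toSemiGraph.IsConnected)
    {v₀ v₁ : G.Vertex} (hv₀ : v₀ ∈ H.verts) (hv₁ : v₁ ∈ H.verts) (he₀ : G.edgeOf b₀ ∈ H.edges)
    (h₀ : G.abuts b₀ = some v₀) {b₀' : G.Branch} (hb₀' : b₀' ≠ b₀)
    (he₀' : G.edgeOf b₀' = G.edgeOf b₀) (h₁ : G.abuts b₀' = some v₁)
    {c c' : G.Branch} (hc₀ : G.edgeOf c ≠ G.edgeOf b₀) (hcc' : G.edgeOf c' = G.edgeOf c)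
    (hce : G.edgeOf c ∈ H.edges) (hc : G.abuts c = some v₀) (hc' : G.abuts c' = some v₁) :
    (⟨(G.cyclicCoverHom b₀ M).vertexMap ⁻¹' H.verts, (G.cyclicCoverHom b₀ M).edgeMap ⁻¹' H.edges⟩ :
      (G.cyclicCover b₀ M).Subgraph).toSemiGraph.IsConnected := by
  classical
  -- notation: `D` = the inverse image of `ℍ`; the level-`i` lift of the nodes of `ℍ`
  obtain ⟨L, hLv, hLe, hLb⟩ : ∃ L : ZMod M → H.toSemiGraph.Node →
      (⟨(G.cyclicCoverHom b₀ M).vertexMap ⁻¹' H.verts, (G.cyclicCoverHom b₀ M).edgeMap ⁻¹' H.edges⟩ :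
        (G.cyclicCover b₀ M).Subgraph).toSemiGraph.Node,
      (∀ i (v : H.toSemiGraph.Vertex), L i (Sum.inl v) = Sum.inl ⟨(v.1, i), v.2⟩) ∧
      (∀ i (e : H.toSemiGraph.Edge), L i (Sum.inr (Sum.inl e)) = Sum.inr (Sum.inl ⟨(e.1, i), e.2⟩)) ∧
      (∀ i (b : H.toSemiGraph.Branch),
        L i (Sum.inr (Sum.inr b)) = Sum.inr (Sum.inr ⟨(b.1, i), b.2⟩)) :=
    ⟨fun i => Sum.elim (fun v => Sum.inl ⟨(v.1, i), v.2⟩) (Sum.elim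
        (fun e => Sum.inr (Sum.inl ⟨(e.1, i), e.2⟩)) (fun b => Sum.inr (Sum.inr ⟨(b.1, i), b.2⟩))),
      fun _ _ => rfl, fun _ _ => rfl, fun _ _ => rfl⟩
  -- the two incidences, lifted: edge — branch inside a level, branch — vertex across the shift
  have adjEB : ∀ (i : ZMod M) (b : H.toSemiGraph.Branch),
      (SemiGraph.subdivision _).Adj (L i (Sum.inr (Sum.inl (H.toSemiGraph.edgeOf b))))
        (L i (Sum.inr (Sum.inr b))) := by
    intro i b
    rw [hLe, hLb]
    refine SemiGraph.subdivision_adj_of_nodeRel _ ?_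
    exact @NodeRel.edge_branch (Subgraph.toSemiGraph (⟨(G.cyclicCoverHom b₀ M).vertexMap ⁻¹' H.verts,
      (G.cyclicCoverHom b₀ M).edgeMap ⁻¹' H.edges⟩ : (G.cyclicCover b₀ M).Subgraph)) ⟨(b.1, i), b.2⟩
  have adjBV : ∀ (i : ZMod M) (b : H.toSemiGraph.Branch) (v : H.toSemiGraph.Vertex)
      (_ : G.abuts b.1 = some v.1),
      (SemiGraph.subdivision _).Adj (L i (Sum.inr (Sum.inr b)))
        (L (G.levelShift b₀ M b.1 i) (Sum.inl v)) := by
    intro i b v hb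
    rw [hLv, hLb]
    refine SemiGraph.subdivision_adj_of_nodeRel _ (NodeRel.branch_vertex _ _ ?_)
    rw [Subgraph.abuts_eq_some_iff]
    change (G.cyclicCover b₀ M).abuts (b.1, i) = some (v.1, G.levelShift b₀ M b.1 i)
    rw [cyclicCover_abuts, hb]
    rfl
  -- adjacent nodes of `ℍ` lift to adjacent nodes (at some level)
  have hadj : ∀ {x y : H.toSemiGraph.Node}, H.toSemiGraph.subdivision.Adj x y →
      ∀ i : ZMod M, ∃ j : ZMod M, (SemiGraph.subdivision _).Adj (L i x) (L j y) := by
    intro x y hxy i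
    rcases (H.toSemiGraph.subdivision_adj_iff).mp hxy with (⟨b⟩ | ⟨b, v, h⟩) | (⟨b⟩ | ⟨b, v, h⟩)
    · exact ⟨i, adjEB i b⟩
    · exact ⟨_, adjBV i b v ((Subgraph.abuts_eq_some_iff H b v).mp h)⟩
    · exact ⟨i, (adjEB i b).symm⟩
    · obtain ⟨i', hi'⟩ := G.levelShift_surjective b₀ M b.1 i
      refine ⟨i', ?_⟩
      have key := adjBV i' b v ((Subgraph.abuts_eq_some_iff H b v).mp h)
      rw [hi'] at key
      exact key.symm
  -- walks of `ℍ` lift (to some level)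
  have hwalk : ∀ {x y : H.toSemiGraph.Node} (_ : H.toSemiGraph.subdivision.Walk x y) (i : ZMod M),
      ∃ j : ZMod M, (SemiGraph.subdivision _).Reachable (L i x) (L j y) := by
    intro x y p
    induction p with
    | nil => exact fun i => ⟨i, SimpleGraph.Reachable.refl _⟩
    | cons hxz _ ih =>
      intro i
      obtain ⟨j₁, hj₁⟩ := hadj hxz i
      obtain ⟨j, hj⟩ := ih j₁
      exact ⟨j, hj₁.reachable.trans hj⟩
  -- the loop `v₁ — e_a — v₀ — e_b — v₁` lifts to a path from level `i` to level `i + 1`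
  have hc₀' : c ≠ b₀ := fun h => hc₀ (h ▸ rfl)
  have hc₀'' : c' ≠ b₀ := fun h => hc₀ (hcc' ▸ h ▸ rfl)
  have hloop : ∀ i : ZMod M, (SemiGraph.subdivision _).Reachable (L i (Sum.inl ⟨v₁, hv₁⟩))
      (L (i + 1) (Sum.inl ⟨v₁, hv₁⟩)) := by
    intro i
    -- the branches as branches of `ℍ`
    let B₀ : H.toSemiGraph.Branch := ⟨b₀, he₀⟩
    let B₀' : H.toSemiGraph.Branch := ⟨b₀', by rw [he₀']; exact he₀⟩
    let C₀ : H.toSemiGraph.Branch := ⟨c, hce⟩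
    let C₀' : H.toSemiGraph.Branch := ⟨c', by rw [hcc']; exact hce⟩
    have hE₀ : H.toSemiGraph.edgeOf B₀' = H.toSemiGraph.edgeOf B₀ := Subtype.ext he₀'
    have hEb : H.toSemiGraph.edgeOf C₀' = H.toSemiGraph.edgeOf C₀ := Subtype.ext hcc'
    -- `v₁ — b₀′ — e_a — b₀ — v₀` (the last incidence raises the level)
    have s1 := adjBV i B₀' ⟨v₁, hv₁⟩ h₁
    rw [G.levelShift_of_ne b₀ M hb₀'] at s1
    have s2 := adjEB i B₀'
    rw [hE₀] at s2
    have s3 := adjEB i B₀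
    have s4 := adjBV i B₀ ⟨v₀, hv₀⟩ h₀
    rw [G.levelShift_self b₀ M] at s4
    -- `v₀ — c — e_b — c′ — v₁` inside level `i + 1`
    have s5 := adjBV (i + 1) C₀ ⟨v₀, hv₀⟩ hc
    rw [G.levelShift_of_ne b₀ M hc₀'] at s5
    have s6 := adjEB (i + 1) C₀
    have s7 := adjEB (i + 1) C₀'
    rw [hEb] at s7
    have s8 := adjBV (i + 1) C₀' ⟨v₁, hv₁⟩ hc'
    rw [G.levelShift_of_ne b₀ M hc₀''] at s8
    exact s1.symm.reachable.trans (s2.symm.reachable.trans (s3.reachable.trans (s4.reachable.trans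
      (s5.symm.reachable.trans (s6.symm.reachable.trans (s7.reachable.trans s8.reachable))))))
  -- hence all the lifts of `v₁` are connected to the one at level `0`
  have hlevels : ∀ j : ZMod M, (SemiGraph.subdivision _).Reachable (L 0 (Sum.inl ⟨v₁, hv₁⟩))
      (L j (Sum.inl ⟨v₁, hv₁⟩)) := by
    intro j
    rw [← ZMod.natCast_zmod_val j]
    induction j.val with
    | zero => rw [Nat.cast_zero]
    | succ n ih => rw [Nat.cast_succ]; exact ih.trans (hloop _)
  -- every node of the inverse image is a lift, hence connected to the base node
  have hreach : ∀ q, (SemiGraph.subdivision _).Reachable (L 0 (Sum.inl ⟨v₁, hv₁⟩)) q := by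
    have key : ∀ (i : ZMod M) (x : H.toSemiGraph.Node),
        (SemiGraph.subdivision _).Reachable (L 0 (Sum.inl ⟨v₁, hv₁⟩)) (L i x) := by
      intro i x
      obtain ⟨p⟩ := hH.connected.preconnected x (Sum.inl ⟨v₁, hv₁⟩)
      obtain ⟨j, hj⟩ := hwalk p i
      exact (hlevels j).trans hj.symm
    rintro (⟨⟨v, i⟩, hv⟩ | ⟨⟨e, i⟩, he⟩ | ⟨⟨b, i⟩, hb⟩)
    · have := key i (Sum.inl ⟨v, hv⟩); rwa [hLv i ⟨v, hv⟩] at this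
    · have := key i (Sum.inr (Sum.inl ⟨e, he⟩)); rwa [hLe i ⟨e, he⟩] at this
    · have := key i (Sum.inr (Sum.inr ⟨b, hb⟩)); rwa [hLb i ⟨b, hb⟩] at this
  haveI : Nonempty (⟨(G.cyclicCoverHom b₀ M).vertexMap ⁻¹' H.verts,
      (G.cyclicCoverHom b₀ M).edgeMap ⁻¹' H.edges⟩ : (G.cyclicCover b₀ M).Subgraph).toSemiGraph.Node :=
    ⟨L 0 (Sum.inl ⟨v₁, hv₁⟩)⟩
  exact ⟨⟨fun p q => (hreach p).symm.trans (hreach q)⟩⟩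

end SemiGraph

end Literature.AnabelianGeometry.SemiGraphs
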